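import Literature.Probability.Percolation.FoldingFibresHarris
import Mathlib.Tactic.Ring
import Mathlib.Tactic.Linarith
import Mathlib.Tactic.Positivity
import HarnessLib

/-!
# `NoHeavyLowerTail` (stmt-CriticalPhenomena-4575) — the Kirkwood identity and the Kirkwood dichotomy for
three positively correlated events

Support file (prover prim-ineq-gen-5 gen 5, new-inequality factory seat; `--supports stmt-CriticalPhenomena-4575`).

For three events `A, B, C` with probabilities `a, b, c`, pair masses `w = μ(A∩B)`, `x = μ(A∩C)`,
`y = μ(B∩C)` and `z = μ(A∩B∩C)`, the **Kirkwood forms** are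
`F := w·x·y − z·a·b·c` ("the Kirkwood superposition value `wxy/(abc)` overestimates `μ(ABC)`") and the same
form for the complements, which by inclusion–exclusion is
`G := (1−a−b+w)(1−a−c+x)(1−b−c+y) − (1−a−b−c+w+x+y−z)(1−a)(1−b)(1−c)`.
The **Kirkwood identity** (`kirkwood_identity`, any commutative ring; the `z`-terms cancel) is
`(1−a)(1−b)(1−c)·F + a·b·c·G = ab(1−a)(1−b)·UV + ac(1−a)(1−c)·KV + bc(1−b)(1−c)·KU + (abc+(1−a)(1−b)(1−c))·KUV`
with the covariances `K = w − ab`, `U = x − ac`, `V = y − bc`.  Hence for pairwise nonnegatively correlated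
events (e.g. three increasing events under a product measure, by Harris) the combination is `≥ 0`
(`kirkwood_combination_nonneg`, `prodBernoulli_kirkwood_combination_nonneg`) and therefore
`F ≥ 0 ∨ G ≥ 0` (`kirkwood_dichotomy`, `prodBernoulli_kirkwood_dichotomy`): Kirkwood overestimates the triple
intersection or overestimates the triple co-intersection.  This is a HARRIS-LEVEL fact (it does not contain the
sharp cubic sunflower row `SF3-Hmax` of `…CubicThreePointSharpDichotomy`: the complements of a sunflower are not a
sunflower); it is recorded because (i) it was found numerically as a 'dichotomy' before the identity was seen,
and (ii) it is a cheap completeness test for LP row dictionaries over partition-lattice events (a point with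
`(1−a)(1−b)(1−c)F + abcG < 0` for some event triple misses a plain Harris pair) — memo
run/shared/lean/prim/prim-ineq-gen-5/FINDINGS-gen5-g5.md §G5-6, G5-7.
-/

namespace Summit.CriticalPhenomena.PercolationContinuityZ3.Theorems

namespace Kirkwood

/-- **Kirkwood identity** (any commutative ring): with `K = w − ab`, `U = x − ac`, `V = y − bc`,
`(1−a)(1−b)(1−c)·F + abc·G = ab(1−a)(1−b)UV + ac(1−a)(1−c)KV + bc(1−b)(1−c)KU + (abc + (1−a)(1−b)(1−c))KUV`;
in particular the triple mass `z` cancels. [folklore] -/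
theorem kirkwood_identity {R : Type*} [CommRing R] (a b c w x y z : R) :
    (1 - a) * (1 - b) * (1 - c) * (w * x * y - z * a * b * c)
      + a * b * c * ((1 - a - b + w) * (1 - a - c + x) * (1 - b - c + y) - (1 - a - b - c + w + x + y - z) * (1 - a) * (1 - b) * (1 - c)) =
      a * b * (1 - a) * (1 - b) * ((x - a * c) * (y - b * c))
        + a * c * (1 - a) * (1 - c) * ((w - a * b) * (y - b * c))
        + b * c * (1 - b) * (1 - c) * ((w - a * b) * (x - a * c))
        + (a * b * c + (1 - a) * (1 - b) * (1 - c)) * ((w - a * b) * (x - a * c) * (y - b * c)) := by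
  ring

/-- **The Kirkwood combination is nonnegative** for probabilities `a,b,c ∈ [0,1]` and pairwise
nonnegative covariances `ab ≤ w`, `ac ≤ x`, `bc ≤ y` (any `z`). [folklore] -/
theorem kirkwood_combination_nonneg {a b c w x y z : ℝ} (ha₀ : 0 ≤ a) (ha₁ : a ≤ 1) (hb₀ : 0 ≤ b)
    (hb₁ : b ≤ 1) (hc₀ : 0 ≤ c) (hc₁ : c ≤ 1) (hw : a * b ≤ w) (hx : a * c ≤ x) (hy : b * c ≤ y) :
    0 ≤ (1 - a) * (1 - b) * (1 - c) * (w * x * y - z * a * b * c)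
      + a * b * c * ((1 - a - b + w) * (1 - a - c + x) * (1 - b - c + y) - (1 - a - b - c + w + x + y - z) * (1 - a) * (1 - b) * (1 - c)) := by
  rw [kirkwood_identity]
  have hK : 0 ≤ w - a * b := sub_nonneg.mpr hw
  have hU : 0 ≤ x - a * c := sub_nonneg.mpr hx
  have hV : 0 ≤ y - b * c := sub_nonneg.mpr hy
  have h1a : 0 ≤ 1 - a := sub_nonneg.mpr ha₁
  have h1b : 0 ≤ 1 - b := sub_nonneg.mpr hb₁
  have h1c : 0 ≤ 1 - c := sub_nonneg.mpr hc₁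
  positivity

/-- **Kirkwood dichotomy**: for `a,b,c ∈ (0,1)` and pairwise nonnegative covariances, `F ≥ 0` or `G ≥ 0`
— the Kirkwood superposition value overestimates the triple intersection, or it overestimates the triple
co-intersection. [folklore] -/
theorem kirkwood_dichotomy {a b c w x y z : ℝ} (ha₀ : 0 < a) (ha₁ : a < 1) (hb₀ : 0 < b) (hb₁ : b < 1)
    (hc₀ : 0 < c) (hc₁ : c < 1) (hw : a * b ≤ w) (hx : a * c ≤ x) (hy : b * c ≤ y) :
    0 ≤ (w * x * y - z * a * b * c) ∨
      0 ≤ ((1 - a - b + w) * (1 - a - c + x) * (1 - b - c + y) - (1 - a - b - c + w + x + y - z) * (1 - a) * (1 - b) * (1 - c)) := by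
  by_contra h
  simp only [not_or, not_le] at h
  obtain ⟨hF, hG⟩ := h
  have hS := kirkwood_combination_nonneg (z := z) ha₀.le ha₁.le hb₀.le hb₁.le hc₀.le hc₁.le hw hx hy
  have h1 : 0 < (1 - a) * (1 - b) * (1 - c) := by
    have : 0 < 1 - a := sub_pos.mpr ha₁
    have : 0 < 1 - b := sub_pos.mpr hb₁
    have : 0 < 1 - c := sub_pos.mpr hc₁
    positivity
  have h2 : 0 < a * b * c := by positivity
  nlinarith [mul_neg_of_pos_of_neg h1 hF, mul_neg_of_pos_of_neg h2 hG]

end Kirkwood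

/-! ### The percolation / product-measure instance (Harris supplies the three covariances) -/

section ProductMeasure

open MeasureTheory Set
open Literature.Probability.LatticeModels (prodBernoulli)
open Literature.Probability.Percolation (prodBernoulli_harris_via_fibres)

variable {ι : Type*} [Fintype ι]

/-- **Kirkwood combination for three increasing events under a product measure** `μ = prodBernoulli p` on
the cube `Set ι`: `(1−μA)(1−μB)(1−μC)·F + μA·μB·μC·G ≥ 0`, with `F, G` the Kirkwood forms in the seven
intersection masses, `G` written by inclusion–exclusion (Harris' inequality gives the three covariances). [folklore] -/
theorem prodBernoulli_kirkwood_combination_nonneg (p : ι → unitInterval) {A B C : Set (Set ι)}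
    (hA : IsUpperSet A) (hB : IsUpperSet B) (hC : IsUpperSet C) :
    let μ := prodBernoulli p
    0 ≤ (1 - μ.real A) * (1 - μ.real B) * (1 - μ.real C) *
          (μ.real (A ∩ B) * μ.real (A ∩ C) * μ.real (B ∩ C) - μ.real (A ∩ B ∩ C) * μ.real A * μ.real B * μ.real C)
        + μ.real A * μ.real B * μ.real C *
          ((1 - μ.real A - μ.real B + μ.real (A ∩ B)) * (1 - μ.real A - μ.real C + μ.real (A ∩ C))
              * (1 - μ.real B - μ.real C + μ.real (B ∩ C))
            - (1 - μ.real A - μ.real B - μ.real C + μ.real (A ∩ B) + μ.real (A ∩ C) + μ.real (B ∩ C)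
                - μ.real (A ∩ B ∩ C)) * (1 - μ.real A) * (1 - μ.real B) * (1 - μ.real C)) :=
  Kirkwood.kirkwood_combination_nonneg measureReal_nonneg measureReal_le_one measureReal_nonneg
    measureReal_le_one measureReal_nonneg measureReal_le_one (prodBernoulli_harris_via_fibres p hA hB)
    (prodBernoulli_harris_via_fibres p hA hC) (prodBernoulli_harris_via_fibres p hB hC)

end ProductMeasure

end Summit.CriticalPhenomena.PercolationContinuityZ3.Theorems
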